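import Literature.Computability.Complexity.PRelOfFunNSUBEXP
import Literature.Computability.Complexity.AdaptiveBPPSimulation
import Literature.Computability.Complexity.FPStringBricks
import Literature.Computability.Complexity.LengthCompare
import HarnessLib

/-!
# Kabanets–Impagliazzo 2003, Lemma 3 in certificate classes: `P^g ⊆ ∃ᵖ·𝒞` when the graph of `g` is
# in `∃ᵖ·𝒞` — in particular `P^g ⊆ ∃·BPP` (`𝒞 = BPP`) and `P^g ⊆ NP` (`𝒞 = P`)

Class level (no machine is programmed). Companion of `PRelOfFunNSUBEXP.lean` (the `NSUBEXP`
instance of Kabanets–Impagliazzo 2003, Lemma 3, p. 357: "If `Perm ∈ NTIME(t)`, then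
`P^{Perm} ⊆ NTIME(poly(n) t(poly(n)))`", folklore proof "guess every oracle answer together with its
certificate"). Here the same folklore argument is carried out for the WITNESS CLASSES
`polyExists 𝒞 = {x | ∃ y, |y| ≤ p(|x|), ⟨x, y⟩ ∈ L'}`, `L' ∈ 𝒞`, over any class `𝒞` that is closed
under the tree's bounded adaptive reductions (`AdQuery.adLang Q q D B ∈ 𝒞` for `Q ∈ FP`, `D ∈ P`,
`B ∈ 𝒞` — the normal form of `P^B`, `PRelAdaptiveForm.lean`): `𝒞 = P` (`AdQuery.adLang_mem_P`,
so `polyExists 𝒞 = NP`) and `𝒞 = BPP` (`AdBPPSim.adLang_mem_BPP`, "`P^{BPP} = BPP`", so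
`polyExists 𝒞 = ∃·BPP`, the class of Babai's Arthur–Merlin games with a `BPP` promise on every
Merlin string, used by Bläser–Ikenmeyer–Jindal–Lysikov 2018).

* `GuardedBallExists.guardedBall_mem_polyExists` — **the guarded ball
  `{x | ∃ Y, |Y| ≤ p(|x|) ∧ ⟨x, Y⟩ ∈ R ∧ ∀ j < |⟨x, Y⟩|, ⟨⟨x, Y⟩, 1ʲ⟩ ∈ S → f ⟨⟨x, Y⟩, 1ʲ⟩ ∈ A}` of
  `NSUBEXPGuardedBall.lean` is in `polyExists 𝒞` whenever `A ∈ polyExists 𝒞`, `R, S ∈ P`, `f ∈ FP`**: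
  guess `W = ⟨Y, body [c₀, …, c_{k−1}]⟩`, one certificate per round, and check the rounds by the
  bounded adaptive reduction whose `j`-th query is `⟨f ⟨⟨x, Y⟩, 1ʲ⟩, c_j⟩` (query map `qFn`) and whose
  verdict reads the answer bits (decision language `dLang`);
* `guardedBall_mem_polyExists_BPP`, `guardedBall_mem_NP` — the two instances;
* `PRel_ofFun_subset_polyExists_of_fnGraph` — **if the graph `{⟨u, bin (g u)⟩}` of a function
  `g : {0,1}* → ℕ` with polynomially long values is in `polyExists 𝒞`, then `P^g ⊆ polyExists 𝒞`**
  (by `FnGraph.mem_iff_mem_guardedBall`: every `L ∈ P^g` IS such a guarded ball of the graph);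
  instances `PRel_ofFun_subset_polyExists_BPP_of_fnGraph` (`∃·BPP`) and
  `PRel_ofFun_subset_NP_of_fnGraph` (`NP`; the folklore "`P^g ⊆ NP` if the graph of `g` is in `NP`").

Consumer: `Barriers/ValiantsHypothesis/BIJL18Thm5OfRandomizedPIT.lean` (Bläser–Ikenmeyer–Jindal–
Lysikov 2018, Thm. 5: `VP⁰ = VNP⁰ ⇒ P^{#P} ⊆ ∃·BPP`, through the permanent oracle).

## References

* V. Kabanets, R. Impagliazzo, *Derandomizing polynomial identity tests means proving circuit
  lower bounds*, STOC 2003, §2.1 and Lemma 3 (p. 357).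
* S. Arora, B. Barak, *Computational Complexity: A Modern Approach*, CUP 2009, §3.4 (oracle
  machines), Def. 2.1 (certificates), §7.5.2 (`BPP^{BPP} = BPP`).
* L. Babai, *Trading group theory for randomness*, STOC 1985 (Arthur–Merlin classes).
-/

noncomputable section

namespace Literature.Computability.Complexity

open _root_.Computability Polynomial Brick PRelSigPi PRelSigma OracleCompose AdQuery

/-! ### A reading lemma for the answer bits of an adaptive reduction -/

/-- The `j`-th answer bit of `adBits Q A x n` (`j < n`) is the indicator of the `j`-th query, which
only depends on the earlier answers (Arora–Barak 2009, §3.4: "the machine's next query may depend on the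
answers to the previous ones"). [cite: AroraBarakCC2009, §3.4] -/
theorem AdQuery.getElem?_adBits (Q : List Bool → List Bool) (A : Language Bool) (x : List Bool) :
    ∀ {n j : ℕ}, j < n →
      (adBits Q A x n)[j]? = some (Set.boolIndicator A (Q (boolPair x (adBits Q A x j))))
  | 0, _, h => absurd h (Nat.not_lt_zero _)
  | n + 1, j, h => by
    rw [adBits_succ]
    rcases Nat.lt_succ_iff_lt_or_eq.1 h with hlt | rfl
    · rw [List.getElem?_append_left (by rw [length_adBits]; exact hlt)]
      exact AdQuery.getElem?_adBits Q A x hlt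
    · rw [List.getElem?_append_right (by rw [length_adBits])]
      simp [length_adBits]

namespace GuardedBallExists

/-! ### The query map and the decision language

Strings: the inner input is `w = ⟨x, W⟩`, the guess `W` being read as `⟨Y, C⟩` (`Y = fstF W`, the
certificate body `C = sndF W`, `j`-th certificate `elemOf C j`); the round word of the adaptive
reduction is `z = ⟨w, bits⟩`; the ball word is `v = ⟨z, J⟩`. -/

section Maps

variable (f : List Bool → List Bool)

/-- `xyFn w = ⟨x, Y⟩` for `w = ⟨x, ⟨Y, C⟩⟩`. [folklore] -/
def xyFn : List Bool → List Bool := fanoutFn fstF (fstF ∘ sndF)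

/-- `xyFn ∈ FP`. [folklore] -/
private theorem xyFn_mem_FP : xyFn ∈ FP := fanoutFn_mem_FP fstF_mem_FP (comp_mem_FP fstF_mem_FP sndF_mem_FP)

/-- `xyFn ⟨x, W⟩ = ⟨x, fstF W⟩`. [folklore] -/
@[simp] private theorem xyFn_boolPair (x W : List Bool) : xyFn (boolPair x W) = boolPair x (fstF W) := by
  simp [xyFn, fanoutFn_apply]

/-- The certificate body `C = sndF (sndF w)`. [folklore] -/
def cFn : List Bool → List Bool := sndF ∘ sndF

/-- `cFn ∈ FP`. [folklore] -/
private theorem cFn_mem_FP : cFn ∈ FP := comp_mem_FP sndF_mem_FP sndF_mem_FP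

/-- `cFn ⟨x, W⟩ = sndF W`. [folklore] -/
@[simp] private theorem cFn_boolPair (x W : List Bool) : cFn (boolPair x W) = sndF W := by simp [cFn]

/-- **The query map** on the round word `z = ⟨w, bits⟩`: `⟨f ⟨xyFn w, 1^{|bits|}⟩, C[|bits|]⟩` — the
`|bits|`-th query of the guarded ball paired with its guessed certificate. [cite: KabanetsImpagliazzo2003, Lemma 3 (p. 357)] -/
def qFn : List Bool → List Bool :=
  fanoutFn (f ∘ fanoutFn (xyFn ∘ fstF) (onesFn ∘ sndF)) (elemFn ∘ fanoutFn sndF (cFn ∘ fstF))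

/-- `qFn f ∈ FP` for `f ∈ FP`. [folklore] -/
private theorem qFn_mem_FP (hf : f ∈ FP) : qFn f ∈ FP :=
  fanoutFn_mem_FP (comp_mem_FP hf (fanoutFn_mem_FP (comp_mem_FP xyFn_mem_FP fstF_mem_FP)
    (comp_mem_FP onesFn_mem_FP sndF_mem_FP)))
    (comp_mem_FP elemFn_mem_FP (fanoutFn_mem_FP sndF_mem_FP (comp_mem_FP cFn_mem_FP fstF_mem_FP)))

/-- `onesFn u = 1^{|u|}`. [folklore] -/
private theorem onesFn_eq_ones (u : List Bool) : onesFn u = ones u.length := by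
  simp [onesFn, unaryEncodeNat_eq_replicate, ones]

/-- Value of the query map on a round word. [folklore] -/
@[simp] private theorem qFn_boolPair (x W bits : List Bool) :
    qFn f (boolPair (boolPair x W) bits) =
      boolPair (f (boolPair (boolPair x (fstF W)) (ones bits.length))) (elemOf (sndF W) bits.length) := by
  simp [qFn, fanoutFn_apply, elemFn_boolPair, onesFn_eq_ones]

/-- The in-range test on the ball word `v = ⟨z, J⟩`: `[|J| < |xyFn (fstF z)|]`. [folklore] -/
def inRangeFn : List Bool → List Bool := ltLenF ∘ fanoutFn sndF (xyFn ∘ fstF ∘ fstF)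

/-- The ball words `⟨⟨w, bits⟩, J⟩` with `|J| < |⟨x, Y⟩|`. [folklore] -/
def InRange : Language Bool := {v | inRangeFn v = [true]}

/-- `InRange ∈ P`. [folklore] -/
private theorem InRange_mem_P : InRange ∈ Classes.P :=
  mem_P_of_mem_FP (comp_mem_FP ltLenF_mem_FP (fanoutFn_mem_FP sndF_mem_FP
    (comp_mem_FP xyFn_mem_FP (comp_mem_FP fstF_mem_FP fstF_mem_FP)))) _ fun v =>
    ⟨fun h => h, fun h => (oneBit_ltLenF _).elim fun b hb => by
      cases b
      · exact hb
      · exact absurd hb h⟩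

/-- Membership of a ball word in `InRange`. [folklore] -/
@[simp] private theorem mem_InRange_iff (x W bits J : List Bool) :
    boolPair (boolPair (boolPair x W) bits) J ∈ InRange ↔ J.length < (boolPair x (fstF W)).length := by
  change (ltLenF ∘ fanoutFn sndF (xyFn ∘ fstF ∘ fstF)) (boolPair (boolPair (boolPair x W) bits) J) = [true] ↔ _
  simp [fanoutFn_apply]

/-- The round's guarded query word `⟨⟨x, Y⟩, J⟩` read off the ball word. [folklore] -/
def roundWordFn : List Bool → List Bool := fanoutFn (xyFn ∘ fstF ∘ fstF) sndF

/-- `roundWordFn ∈ FP`. [folklore] -/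
private theorem roundWordFn_mem_FP : roundWordFn ∈ FP :=
  fanoutFn_mem_FP (comp_mem_FP xyFn_mem_FP (comp_mem_FP fstF_mem_FP fstF_mem_FP)) sndF_mem_FP

/-- Value of `roundWordFn` on a ball word. [folklore] -/
@[simp] private theorem roundWordFn_apply (x W bits J : List Bool) :
    roundWordFn (boolPair (boolPair (boolPair x W) bits) J) = boolPair (boolPair x (fstF W)) J := by
  simp [roundWordFn, fanoutFn_apply]

/-- The round's query/certificate pair `⟨f ⟨⟨x, Y⟩, J⟩, C[|J|]⟩` read off the ball word. [folklore] -/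
def certPairFn : List Bool → List Bool :=
  fanoutFn (f ∘ roundWordFn) (elemFn ∘ fanoutFn sndF (cFn ∘ fstF ∘ fstF))

/-- `certPairFn f ∈ FP` for `f ∈ FP`. [folklore] -/
private theorem certPairFn_mem_FP (hf : f ∈ FP) : certPairFn f ∈ FP :=
  fanoutFn_mem_FP (comp_mem_FP hf roundWordFn_mem_FP)
    (comp_mem_FP elemFn_mem_FP (fanoutFn_mem_FP sndF_mem_FP
      (comp_mem_FP cFn_mem_FP (comp_mem_FP fstF_mem_FP fstF_mem_FP))))

/-- Value of `certPairFn` on a ball word. [folklore] -/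
@[simp] private theorem certPairFn_apply (x W bits J : List Bool) :
    certPairFn f (boolPair (boolPair (boolPair x W) bits) J) =
      boolPair (f (boolPair (boolPair x (fstF W)) J)) (elemOf (sndF W) J.length) := by
  simp [certPairFn, fanoutFn_apply, elemFn_boolPair]

/-- The answer bit of the round, `[bits[|J|]]`, read off the ball word. [folklore] -/
def bitFn : List Bool → List Bool := bitAtFn ∘ fanoutFn sndF (sndF ∘ fstF)

/-- `bitFn ∈ FP`. [folklore] -/
private theorem bitFn_mem_FP : bitFn ∈ FP :=
  comp_mem_FP bitAtFn_mem_FP (fanoutFn_mem_FP sndF_mem_FP (comp_mem_FP sndF_mem_FP fstF_mem_FP))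

/-- Value of `bitFn` on a ball word. [folklore] -/
@[simp] private theorem bitFn_apply (w bits J : List Bool) :
    bitFn (boolPair (boolPair w bits) J) = (bits.drop J.length).take 1 := by
  simp [bitFn, fanoutFn_apply, bitAtFn_boolPair]

variable (S : Language Bool) (pA : Polynomial ℕ)

/-- **The round language** on ball words `⟨⟨⟨x, W⟩, bits⟩, J⟩`: if the round `|J|` is in range and
guarded (`⟨⟨x, Y⟩, J⟩ ∈ S`) then its certificate is short (`|C[|J|]| ≤ pA(|f ⟨⟨x, Y⟩, J⟩|)`) and its
answer bit is `1`. [cite: KabanetsImpagliazzo2003, Lemma 3 (p. 357)] -/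
def roundLang : Language Bool :=
  InRangeᶜ ⊔ ((roundWordFn ⁻¹' S)ᶜ ⊔ (certPairFn f ⁻¹' LenLe pA ⊓ bitFn ⁻¹' HeadIs true))

/-- `roundLang f S pA ∈ P` for `f ∈ FP`, `S ∈ P`. [folklore] -/
private theorem roundLang_mem_P (hf : f ∈ FP) (hS : S ∈ Classes.P) : roundLang f S pA ∈ Classes.P :=
  union_mem_P (compl_mem_P_iff.2 InRange_mem_P)
    (union_mem_P (compl_mem_P_iff.2 (preimage_mem_P hS roundWordFn_mem_FP))
      (inter_mem_P (preimage_mem_P (LenLe_mem_P pA) (certPairFn_mem_FP f hf))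
        (preimage_mem_P (HeadIs_mem_P true) bitFn_mem_FP)))

/-- Membership in `LenLe`. [folklore] -/
private theorem boolPair_mem_LenLe_iff (p : Polynomial ℕ) (a b : List Bool) :
    boolPair a b ∈ LenLe p ↔ b.length ≤ p.eval a.length := by
  change lenLeFn p (boolPair a b) = [true] ↔ _
  rw [lenLeFn_boolPair]
  simp

/-- **Membership of a ball word in the round language.** [folklore] -/
private theorem mem_roundLang_iff (x W bits J : List Bool) :
    boolPair (boolPair (boolPair x W) bits) J ∈ roundLang f S pA ↔
      (J.length < (boolPair x (fstF W)).length → boolPair (boolPair x (fstF W)) J ∈ S →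
        (elemOf (sndF W) J.length).length ≤ pA.eval (f (boolPair (boolPair x (fstF W)) J)).length ∧
          bits[J.length]? = some true) := by
  have hbit : bitFn (boolPair (boolPair (boolPair x W) bits) J) ∈ HeadIs true ↔
      bits[J.length]? = some true := by
    change (bitFn (boolPair (boolPair (boolPair x W) bits) J)).head? = some true ↔ _
    rw [bitFn_apply, List.head?_take]
    simp
  change (¬ boolPair (boolPair (boolPair x W) bits) J ∈ InRange ∨
      (¬ roundWordFn (boolPair (boolPair (boolPair x W) bits) J) ∈ S ∨
        (certPairFn f (boolPair (boolPair (boolPair x W) bits) J) ∈ LenLe pA ∧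
          bitFn (boolPair (boolPair (boolPair x W) bits) J) ∈ HeadIs true))) ↔ _
  rw [hbit, mem_InRange_iff, roundWordFn_apply, certPairFn_apply, boolPair_mem_LenLe_iff]
  constructor
  · rintro (h | h | h) h1 h2
    · exact absurd h1 h
    · exact absurd h2 h
    · exact h
  · intro h
    by_cases h1 : J.length < (boolPair x (fstF W)).length
    · by_cases h2 : boolPair (boolPair x (fstF W)) J ∈ S
      · exact Or.inr (Or.inr (h h1 h2))
      · exact Or.inr (Or.inl h2)
    · exact Or.inl h1

variable (R : Language Bool) (p : Polynomial ℕ)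

/-- **The decision language** of the adaptive reduction on round words `z = ⟨⟨x, W⟩, bits⟩`:
`|Y| ≤ p(|x|)`, `⟨x, Y⟩ ∈ R`, and every round `j < |z|` satisfies the round language.
[cite: KabanetsImpagliazzo2003, Lemma 3 (p. 357)] -/
def dLang : Language Bool :=
  ((xyFn ∘ fstF) ⁻¹' LenLe p ⊓ (xyFn ∘ fstF) ⁻¹' R) ⊓
    {z | ∀ j < z.length, boolPair z (ones j) ∈ roundLang f S pA}

/-- `dLang f S pA R p ∈ P` for `f ∈ FP`, `R, S ∈ P` (`Brick.ballLen_mem_P` for the rounds). [cite: AroraBarakCC2009, §1.3 (bounded loops)] -/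
private theorem dLang_mem_P (hf : f ∈ FP) (hS : S ∈ Classes.P) (hR : R ∈ Classes.P) :
    dLang f S pA R p ∈ Classes.P :=
  inter_mem_P
    (inter_mem_P (preimage_mem_P (LenLe_mem_P p) (comp_mem_FP xyFn_mem_FP fstF_mem_FP))
      (preimage_mem_P hR (comp_mem_FP xyFn_mem_FP fstF_mem_FP)))
    (ballLen_mem_P (roundLang_mem_P f S pA hf hS))

/-- **Membership of a round word in the decision language.** [folklore] -/
private theorem mem_dLang_iff (x W bits : List Bool) :
    boolPair (boolPair x W) bits ∈ dLang f S pA R p ↔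
      (fstF W).length ≤ p.eval x.length ∧ boolPair x (fstF W) ∈ R ∧
        ∀ j < (boolPair (boolPair x W) bits).length, j < (boolPair x (fstF W)).length →
          boolPair (boolPair x (fstF W)) (ones j) ∈ S →
            (elemOf (sndF W) j).length ≤ pA.eval (f (boolPair (boolPair x (fstF W)) (ones j))).length ∧
              bits[j]? = some true := by
  change ((xyFn (fstF (boolPair (boolPair x W) bits)) ∈ LenLe p ∧
      xyFn (fstF (boolPair (boolPair x W) bits)) ∈ R) ∧
      ∀ j < (boolPair (boolPair x W) bits).length,
        boolPair (boolPair (boolPair x W) bits) (ones j) ∈ roundLang f S pA) ↔ _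
  rw [fstF_boolPair, xyFn_boolPair, boolPair_mem_LenLe_iff, and_assoc]
  refine and_congr Iff.rfl (and_congr Iff.rfl (forall_congr' fun j => forall_congr' fun _ => ?_))
  rw [mem_roundLang_iff]
  simp only [ones, List.length_replicate]

end Maps

/-! ### The guarded ball is a witness language over `𝒞` -/

section Main

variable {𝒞 : Set (Language Bool)}

/-- **The witness polynomial**: with `K(n) = 2n + 2 + p(n) ≥ |⟨x, Y⟩|` (the number of rounds) and
`b(n) = pA(pf(3K(n) + 2))` (a bound on every certificate, `pf` bounding the length of `f`'s values),
the guess `W = ⟨Y, body [c₀, …, c_{k−1}]⟩` has `|W| ≤ 2p(n) + 2 + K(n)(2b(n) + 2)`. [folklore] -/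
def wPoly (p pA pf : Polynomial ℕ) : Polynomial ℕ :=
  Polynomial.C 2 * p + Polynomial.C 2 +
    (Polynomial.C 2 * X + Polynomial.C 2 + p) *
      (Polynomial.C 2 * pA.comp (pf.comp (Polynomial.C 3 * (Polynomial.C 2 * X + Polynomial.C 2 + p) +
        Polynomial.C 2)) + Polynomial.C 2)

/-- Evaluation of the witness polynomial. [folklore] -/
private theorem eval_wPoly (p pA pf : Polynomial ℕ) (n : ℕ) :
    (wPoly p pA pf).eval n = 2 * p.eval n + 2 +
      (2 * n + 2 + p.eval n) * (2 * pA.eval (pf.eval (3 * (2 * n + 2 + p.eval n) + 2)) + 2) := by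
  simp [wPoly, eval_comp]

/-- **The guarded ball of a `polyExists 𝒞`-language along `(R, S, f, p)` (`R, S ∈ P`, `f ∈ FP`) is in
`polyExists 𝒞`**, for every class `𝒞` closed under bounded adaptive reductions
(`AdQuery.adLang Q q D B ∈ 𝒞` for `Q ∈ FP`, `D ∈ P`, `B ∈ 𝒞`). Witness: `W = ⟨Y, body cs⟩`, one
certificate per round; witness language: the adaptive reduction with query map `qFn f` and decision
language `dLang f S pA R p` to the witness language `B` of `A`.
[cite: KabanetsImpagliazzo2003, Lemma 3 (p. 357)] [cite: AroraBarakCC2009, §7.5.2] -/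
theorem guardedBall_mem_polyExists
    (hclos : ∀ {Q : List Bool → List Bool} {D B : Language Bool} (q : Polynomial ℕ),
      Q ∈ FP → D ∈ Classes.P → B ∈ 𝒞 → adLang Q q D B ∈ 𝒞)
    {A R S : Language Bool} {f : List Bool → List Bool} (p : Polynomial ℕ)
    (hA : A ∈ polyExists 𝒞) (hR : R ∈ Classes.P) (hS : S ∈ Classes.P) (hf : f ∈ FP) :
    guardedBall A R S f p ∈ polyExists 𝒞 := by
  classical
  obtain ⟨B, hB, pA, hAB⟩ := hA
  obtain ⟨pf, hpf⟩ := exists_poly_length_le_of_mem_FP hf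
  refine ⟨adLang (qFn f) X (dLang f S pA R p) B, hclos X (qFn_mem_FP f hf) (dLang_mem_P f S pA R p hf hS hR) hB,
    wPoly p pA pf, fun x => ⟨fun hx => ?_, fun hx => ?_⟩⟩
  · -- (⇒): guess `Y` and one certificate per guarded round
    obtain ⟨Y, hY, hxR, hall⟩ := (mem_guardedBall_iff).1 hx
    set k := (boolPair x Y).length with hk
    -- the certificates
    have hcert : ∀ j, ∃ c : List Bool, (j < k → boolPair (boolPair x Y) (ones j) ∈ S →
        c.length ≤ pA.eval (f (boolPair (boolPair x Y) (ones j))).length ∧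
          boolPair (f (boolPair (boolPair x Y) (ones j))) c ∈ B) ∧
        c.length ≤ pA.eval (pf.eval (3 * k + 2)) := by
      intro j
      by_cases hj : j < k ∧ boolPair (boolPair x Y) (ones j) ∈ S
      · obtain ⟨c, hc, hcB⟩ := (hAB _).1 (hall j hj.1 hj.2)
        refine ⟨c, fun _ _ => ⟨hc, hcB⟩, hc.trans (TM2Iter.eval_mono pA ((hpf _).trans
          (TM2Iter.eval_mono pf ?_)))⟩
        rw [length_boolPair]
        simp only [ones, List.length_replicate]
        omega
      · exact ⟨[], fun h1 h2 => absurd ⟨h1, h2⟩ hj, Nat.zero_le _⟩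
    choose c hc using hcert
    set cs : List (List Bool) := (List.range k).map c with hcs
    have hcsj : ∀ j < k, elemOf (body cs) j = c j := fun j hj => by
      rw [elemOf_body, List.getD_eq_getElem _ _ (by simpa [hcs] using hj)]
      simp [hcs]
    refine ⟨boolPair Y (body cs), ?_, ?_⟩
    · -- the length of the guess
      have hK : k ≤ 2 * x.length + 2 + p.eval x.length := by rw [hk, length_boolPair]; omega
      have hb : ∀ z ∈ cs, z.length ≤ pA.eval (pf.eval (3 * (2 * x.length + 2 + p.eval x.length) + 2)) := by
        intro z hz
        obtain ⟨j, -, rfl⟩ := List.mem_map.1 hz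
        exact (hc j).2.trans (TM2Iter.eval_mono pA (TM2Iter.eval_mono pf (by omega)))
      have hbody := length_body_le hb
      have hlen : cs.length = k := by simp [hcs]
      rw [length_boolPair, eval_wPoly]
      rw [hlen] at hbody
      have := Nat.mul_le_mul_right
        (2 * pA.eval (pf.eval (3 * (2 * x.length + 2 + p.eval x.length) + 2)) + 2) hK
      omega
    · -- the adaptive reduction accepts
      rw [mem_adLang_iff, mem_dLang_iff]
      simp only [fstF_boolPair, sndF_boolPair]
      refine ⟨hY, hxR, fun j _ hjk hjS => ?_⟩
      rw [← hk] at hjk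
      obtain ⟨hcl, hcB⟩ := (hc j).1 hjk hjS
      refine ⟨by rw [hcsj j hjk]; exact hcl, ?_⟩
      have hjn : j < X.eval (boolPair x (boolPair Y (body cs))).length := by
        have h1 := length_boolPair x (boolPair Y (body cs))
        have h2 := length_boolPair Y (body cs)
        rw [hk, length_boolPair] at hjk
        simp only [eval_X]
        omega
      rw [AdQuery.getElem?_adBits _ _ _ hjn, qFn_boolPair, fstF_boolPair, sndF_boolPair, length_adBits,
        hcsj j hjk]
      simpa using (Set.mem_iff_boolIndicator _ _).1 hcB
  · -- (⇐): the certified rounds put every guarded query in `A`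
    obtain ⟨W, -, hW⟩ := hx
    rw [mem_adLang_iff, mem_dLang_iff] at hW
    obtain ⟨hY, hxR, hall⟩ := hW
    refine (mem_guardedBall_iff).2 ⟨fstF W, hY, hxR, fun j hj hjS => ?_⟩
    have hWY : (boolPair x (fstF W)).length ≤ (boolPair x W).length := by
      rw [length_boolPair, length_boolPair]
      have := length_fstF_sndF_le W
      omega
    have hjz : j < (boolPair (boolPair x W)
        (adBits (qFn f) B (boolPair x W) (X.eval (boolPair x W).length))).length := by
      rw [length_boolPair]
      omega
    obtain ⟨hcl, hbit⟩ := hall j hjz hj hjS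
    have hjn : j < X.eval (boolPair x W).length := by simp only [eval_X]; omega
    rw [AdQuery.getElem?_adBits _ _ _ hjn, qFn_boolPair, length_adBits] at hbit
    refine (hAB _).2 ⟨elemOf (sndF W) j, hcl, (Set.mem_iff_boolIndicator _ _).2 ?_⟩
    simpa using hbit

/-- **`𝒞 = BPP`: the guarded ball of an `∃·BPP` language is in `∃·BPP`** (`P^{BPP} = BPP`,
`AdBPPSim.adLang_mem_BPP`). [cite: AroraBarakCC2009, §7.5.2] -/
theorem guardedBall_mem_polyExists_BPP {A R S : Language Bool} {f : List Bool → List Bool}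
    (p : Polynomial ℕ) (hA : A ∈ polyExists BPP) (hR : R ∈ Classes.P) (hS : S ∈ Classes.P)
    (hf : f ∈ FP) : guardedBall A R S f p ∈ polyExists BPP :=
  guardedBall_mem_polyExists (fun q hQ hD hB => AdBPPSim.adLang_mem_BPP hB hQ q hD) p hA hR hS hf

/-- **`𝒞 = P`: the guarded ball of an `NP` language is in `NP`.** [cite: AroraBarakCC2009, Def. 2.1] -/
theorem guardedBall_mem_NP {A R S : Language Bool} {f : List Bool → List Bool}
    (p : Polynomial ℕ) (hA : A ∈ Nondeterministic.NP) (hR : R ∈ Classes.P) (hS : S ∈ Classes.P)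
    (hf : f ∈ FP) : guardedBall A R S f p ∈ Nondeterministic.NP :=
  guardedBall_mem_polyExists (𝒞 := Classes.P) (fun _ hQ hD hB => adLang_mem_P hQ hD hB) p hA hR hS hf

/-! ### `P^g ⊆ polyExists 𝒞` when the graph of `g` is in `polyExists 𝒞` -/

/-- **Kabanets–Impagliazzo 2003, Lemma 3, witness-class form.** If the graph language
`{⟨u, bin (g u)⟩}` of a function `g : {0,1}* → ℕ` with polynomially long values is in `polyExists 𝒞`,
`𝒞` closed under bounded adaptive reductions, then `P^g ⊆ polyExists 𝒞` (`P^g = PRel (Oracle.ofFun g)`):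
every `L ∈ P^g` is the guarded ball of the graph along its replay data
(`FnGraph.mem_iff_mem_guardedBall`). [cite: KabanetsImpagliazzo2003, Lemma 3 (p. 357)] -/
theorem PRel_ofFun_subset_polyExists_of_fnGraph
    (hclos : ∀ {Q : List Bool → List Bool} {D B : Language Bool} (q : Polynomial ℕ),
      Q ∈ FP → D ∈ Classes.P → B ∈ 𝒞 → adLang Q q D B ∈ 𝒞)
    {g : List Bool → ℕ} {s : Polynomial ℕ}
    (hs : ∀ u, (encodeNat (g u)).length ≤ s.eval u.length) (hG : fnGraph g ∈ polyExists 𝒞) :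
    PRel (Oracle.ofFun g) ⊆ polyExists 𝒞 := by
  intro L hL
  obtain ⟨M, hM, q, hq⟩ := hL
  have heq : L = guardedBall (fnGraph g) (FnGraph.replayR M) FnGraph.SLt (FnGraph.qaFn M) (FnGraph.qY q s) :=
    Set.ext fun x => FnGraph.mem_iff_mem_guardedBall hs hq x
  rw [heq]
  exact guardedBall_mem_polyExists hclos _ hG (FnGraph.replayR_mem_P M hM) FnGraph.SLt_mem_P
    (FnGraph.qaFn_mem_FP M hM)

/-- **`P^g ⊆ ∃·BPP` when the graph of `g` (polynomially long values) is in `∃·BPP`.**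
[cite: KabanetsImpagliazzo2003, Lemma 3 (p. 357)] [cite: AroraBarakCC2009, §7.5.2] -/
theorem PRel_ofFun_subset_polyExists_BPP_of_fnGraph {g : List Bool → ℕ} {s : Polynomial ℕ}
    (hs : ∀ u, (encodeNat (g u)).length ≤ s.eval u.length) (hG : fnGraph g ∈ polyExists BPP) :
    PRel (Oracle.ofFun g) ⊆ polyExists BPP :=
  PRel_ofFun_subset_polyExists_of_fnGraph (fun q hQ hD hB => AdBPPSim.adLang_mem_BPP hB hQ q hD) hs hG

/-- **`P^g ⊆ NP` when the graph of `g` (polynomially long values) is in `NP`** (folklore; Arora–Barak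
2009, §3.4). [cite: KabanetsImpagliazzo2003, Lemma 3 (p. 357)] -/
theorem PRel_ofFun_subset_NP_of_fnGraph {g : List Bool → ℕ} {s : Polynomial ℕ}
    (hs : ∀ u, (encodeNat (g u)).length ≤ s.eval u.length) (hG : fnGraph g ∈ Nondeterministic.NP) :
    PRel (Oracle.ofFun g) ⊆ Nondeterministic.NP :=
  PRel_ofFun_subset_polyExists_of_fnGraph (𝒞 := Classes.P) (fun _ hQ hD hB => adLang_mem_P hQ hD hB) hs hG

end Main

end GuardedBallExists

end Literature.Computability.Complexity

end
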